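import Mathlib

/-!
# Crux `FeketeSOS.CharPSparseSOS` (stmt-ValiantsHypothesis-14989), line `Sketch-ideator5` — stub `stub_degenerateQuadruples`

Degenerate quadruples.  For a prime `p`, `χ_p = legendreSym p`, `Q : Finset ℕ` and the four-point sums
`S(a,b,c,d) = Σ_{x<p} χ_p((x+a)(x+b)(x+c)(x+d))`: if every `{u,u,v,w}`-pattern sum (`u, v, w ∈ Q`
pairwise distinct) is `≤ 0`, then the non-pairwise-distinct quadruples of `Q⁴` contribute at most
`16 · p · #Q²` to `Σ_{Q⁴} S`.

Proof.  A non-distinct quadruple either takes at most two values — there are at most `16 #Q²` of them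
(each is the image of a pair `(u,v) ∈ Q²` and a pattern in `Bool⁴`), and each has `S ≤ p` termwise since
`|χ_p| ≤ 1` — or it has exactly one coincidence, i.e. it is a rearrangement of a pattern `{u,u,v,w}` with
`u, v, w` pairwise distinct, whose sum is `≤ 0` by hypothesis (commute the four factors inside `χ_p`).
-/

-- `Summit.ValiantsHypothesis.ValiantsHypothesis.…` is the tree's mandated single-conjunct layout (Sub = Summit).
set_option linter.dupNamespace false

namespace Summit.ValiantsHypothesis.ValiantsHypothesis.Theorems.CharPSparseSOSTraceBias

open Finset

/-- `|legendreSym p a| ≤ 1`. -/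
theorem dq_abs_legendreSym_le_one (p : ℕ) [Fact p.Prime] (a : ℤ) : |legendreSym p a| ≤ 1 := by
  rcases eq_or_ne (a : ZMod p) 0 with h | h
  · rw [(legendreSym.eq_zero_iff p a).mpr h]; simp
  · rcases legendreSym.eq_one_or_neg_one p h with h1 | h1 <;> simp [h1]

/-- A sum of `p` Legendre symbols is at most `p`. -/
theorem dq_sum_legendreSym_le (p : ℕ) [Fact p.Prime] (f : ℕ → ℤ) :
    (∑ x ∈ range p, legendreSym p (f x)) ≤ (p : ℤ) := by
  calc (∑ x ∈ range p, legendreSym p (f x)) ≤ ∑ _x ∈ range p, (1 : ℤ) :=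
        Finset.sum_le_sum fun x _ => (abs_le.mp (dq_abs_legendreSym_le_one p (f x))).2
    _ = p := by simp

/-- Rearranged `{u,u,v,w}` patterns are `≤ 0` under the hypothesis `H211`. -/
theorem dq_sum_le_zero_of_perm (p : ℕ) [Fact p.Prime] (Q : Finset ℕ)
    (h211 : ∀ u ∈ Q, ∀ v ∈ Q, ∀ w ∈ Q, u ≠ v → u ≠ w → v ≠ w →
      (∑ x ∈ range p, legendreSym p (((x : ℤ) + u) * ((x : ℤ) + u) * ((x : ℤ) + v) * ((x : ℤ) + w))) ≤ 0)
    (a b c d u v w : ℕ) (hu : u ∈ Q) (hv : v ∈ Q) (hw : w ∈ Q) (huv : u ≠ v) (huw : u ≠ w)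
    (hvw : v ≠ w)
    (hperm : ∀ x : ℤ, (x + a) * (x + b) * (x + c) * (x + d) = (x + u) * (x + u) * (x + v) * (x + w)) :
    (∑ x ∈ range p, legendreSym p (((x : ℤ) + a) * ((x : ℤ) + b) * ((x : ℤ) + c) * ((x : ℤ) + d))) ≤
      0 := by
  calc (∑ x ∈ range p, legendreSym p (((x : ℤ) + a) * ((x : ℤ) + b) * ((x : ℤ) + c) * ((x : ℤ) + d)))
        = ∑ x ∈ range p, legendreSym p (((x : ℤ) + u) * ((x : ℤ) + u) * ((x : ℤ) + v) * ((x : ℤ) + w)) :=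
          Finset.sum_congr rfl fun x _ => by rw [hperm]
    _ ≤ 0 := h211 u hu v hv w hw huv huw hvw

/-- Termwise bound: a non-distinct quadruple has `S ≤ p` if it takes at most two values and `S ≤ 0`
otherwise (exactly one coincidence, pattern `{u,u,v,w}`). -/
theorem dq_term_le (p : ℕ) [Fact p.Prime] (Q : Finset ℕ)
    (h211 : ∀ u ∈ Q, ∀ v ∈ Q, ∀ w ∈ Q, u ≠ v → u ≠ w → v ≠ w →
      (∑ x ∈ range p, legendreSym p (((x : ℤ) + u) * ((x : ℤ) + u) * ((x : ℤ) + v) * ((x : ℤ) + w))) ≤ 0)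
    (a b c d : ℕ) (ha : a ∈ Q) (hb : b ∈ Q) (hc : c ∈ Q) (hd : d ∈ Q)
    (hnd : ¬ (a ≠ b ∧ a ≠ c ∧ a ≠ d ∧ b ≠ c ∧ b ≠ d ∧ c ≠ d)) :
    (∑ x ∈ range p, legendreSym p (((x : ℤ) + a) * ((x : ℤ) + b) * ((x : ℤ) + c) * ((x : ℤ) + d))) ≤
      if (a = b ∧ c = d) ∨ (a = c ∧ b = d) ∨ (a = d ∧ b = c) ∨ (a = b ∧ b = c) ∨ (a = b ∧ b = d) ∨
          (a = c ∧ c = d) ∨ (b = c ∧ c = d) then (p : ℤ) else 0 := by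
  split_ifs with hP
  · exact dq_sum_legendreSym_le p _
  · by_cases hab : a = b
    · -- pattern `(u,u,v,w)` with `u = b`, `v = c`, `w = d`
      refine dq_sum_le_zero_of_perm p Q h211 a b c d b c d hb hc hd ?_ ?_ ?_ (fun x => by rw [hab])
      · exact fun hbc => hP (Or.inr <| Or.inr <| Or.inr <| Or.inl ⟨hab, hbc⟩)
      · exact fun hbd => hP (Or.inr <| Or.inr <| Or.inr <| Or.inr <| Or.inl ⟨hab, hbd⟩)
      · exact fun hcd => hP (Or.inl ⟨hab, hcd⟩)
    by_cases hac : a = c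
    · -- `u = c`, `v = b`, `w = d`
      refine dq_sum_le_zero_of_perm p Q h211 a b c d c b d hc hb hd ?_ ?_ ?_
        (fun x => by rw [hac]; ring)
      · exact fun hcb => hab (hac.trans hcb)
      · exact fun hcd => hP (Or.inr <| Or.inr <| Or.inr <| Or.inr <| Or.inr <| Or.inl ⟨hac, hcd⟩)
      · exact fun hbd => hP (Or.inr <| Or.inl ⟨hac, hbd⟩)
    by_cases had : a = d
    · -- `u = d`, `v = b`, `w = c`
      refine dq_sum_le_zero_of_perm p Q h211 a b c d d b c hd hb hc ?_ ?_ ?_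
        (fun x => by rw [had]; ring)
      · exact fun hdb => hab (had.trans hdb)
      · exact fun hdc => hac (had.trans hdc)
      · exact fun hbc => hP (Or.inr <| Or.inr <| Or.inl ⟨had, hbc⟩)
    by_cases hbc : b = c
    · -- `u = c`, `v = a`, `w = d`
      refine dq_sum_le_zero_of_perm p Q h211 a b c d c a d hc ha hd ?_ ?_ had
        (fun x => by rw [hbc]; ring)
      · exact fun hca => hac hca.symm
      · exact fun hcd => hP (Or.inr <| Or.inr <| Or.inr <| Or.inr <| Or.inr <| Or.inr ⟨hbc, hcd⟩)
    by_cases hbd : b = d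
    · -- `u = d`, `v = a`, `w = c`
      refine dq_sum_le_zero_of_perm p Q h211 a b c d d a c hd ha hc ?_ ?_ hac
        (fun x => by rw [hbd]; ring)
      · exact fun hda => had hda.symm
      · exact fun hdc => hbc (hbd.trans hdc)
    by_cases hcd : c = d
    · -- `u = d`, `v = a`, `w = b`
      refine dq_sum_le_zero_of_perm p Q h211 a b c d d a b hd ha hb ?_ ?_ hab
        (fun x => by rw [hcd]; ring)
      · exact fun hda => had hda.symm
      · exact fun hdb => hbd hdb.symm
    exact (hnd ⟨hab, hac, had, hbc, hbd, hcd⟩).elim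

/-- Counting: at most `16 #Q²` quadruples of `Q⁴` take at most two values. -/
theorem dq_card_twoValued_le (Q : Finset ℕ) :
    (((Q ×ˢ Q) ×ˢ (Q ×ˢ Q)).filter (fun t : (ℕ × ℕ) × (ℕ × ℕ) =>
        (t.1.1 = t.1.2 ∧ t.2.1 = t.2.2) ∨ (t.1.1 = t.2.1 ∧ t.1.2 = t.2.2) ∨
          (t.1.1 = t.2.2 ∧ t.1.2 = t.2.1) ∨ (t.1.1 = t.1.2 ∧ t.1.2 = t.2.1) ∨
          (t.1.1 = t.1.2 ∧ t.1.2 = t.2.2) ∨ (t.1.1 = t.2.1 ∧ t.2.1 = t.2.2) ∨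
          (t.1.2 = t.2.1 ∧ t.2.1 = t.2.2))).card ≤ 16 * Q.card ^ 2 := by
  classical
  have hsub : ((Q ×ˢ Q) ×ˢ (Q ×ˢ Q)).filter (fun t : (ℕ × ℕ) × (ℕ × ℕ) =>
        (t.1.1 = t.1.2 ∧ t.2.1 = t.2.2) ∨ (t.1.1 = t.2.1 ∧ t.1.2 = t.2.2) ∨
          (t.1.1 = t.2.2 ∧ t.1.2 = t.2.1) ∨ (t.1.1 = t.1.2 ∧ t.1.2 = t.2.1) ∨
          (t.1.1 = t.1.2 ∧ t.1.2 = t.2.2) ∨ (t.1.1 = t.2.1 ∧ t.2.1 = t.2.2) ∨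
          (t.1.2 = t.2.1 ∧ t.2.1 = t.2.2)) ⊆
      ((Q ×ˢ Q) ×ˢ (univ : Finset (Bool × Bool × Bool × Bool))).image
        (fun z : (ℕ × ℕ) × (Bool × Bool × Bool × Bool) =>
          ((cond z.2.1 z.1.1 z.1.2, cond z.2.2.1 z.1.1 z.1.2),
            (cond z.2.2.2.1 z.1.1 z.1.2, cond z.2.2.2.2 z.1.1 z.1.2))) := by
    rintro ⟨⟨a, b⟩, ⟨c, d⟩⟩ ht
    simp only [mem_filter, mem_product] at ht
    obtain ⟨⟨⟨ha, hb⟩, ⟨hc, hd⟩⟩, hP⟩ := ht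
    rw [mem_image]
    rcases hP with ⟨h1, h2⟩ | ⟨h1, h2⟩ | ⟨h1, h2⟩ | ⟨h1, h2⟩ | ⟨h1, h2⟩ | ⟨h1, h2⟩ | ⟨h1, h2⟩
    · exact ⟨((a, c), (true, true, false, false)), by simp [ha, hc], by simp [h1, h2]⟩
    · exact ⟨((a, b), (true, false, true, false)), by simp [ha, hb], by simp [h1, h2]⟩
    · exact ⟨((a, b), (true, false, false, true)), by simp [ha, hb], by simp [h1, h2]⟩
    · exact ⟨((a, d), (true, true, true, false)), by simp [ha, hd], by simp [h1, h2]⟩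
    · exact ⟨((a, c), (true, true, false, true)), by simp [ha, hc], by simp [h1, h2]⟩
    · exact ⟨((a, b), (true, false, true, true)), by simp [ha, hb], by simp [h1, h2]⟩
    · exact ⟨((a, b), (true, false, false, false)), by simp [ha, hb], by simp [h1, h2]⟩
  calc _ ≤ _ := card_le_card hsub
    _ ≤ ((Q ×ˢ Q) ×ˢ (univ : Finset (Bool × Bool × Bool × Bool))).card := card_image_le
    _ = 16 * Q.card ^ 2 := by simp [card_univ, Fintype.card_prod, Fintype.card_bool]; ring

/-- **Stub 6 (degenerate quadruples, elementary).**  If every `{u,u,v,w}`-pattern sum is `≤ 0`, the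
non-distinct quadruples of `Q⁴` contribute at most `16 p #Q²` to `Σ_{Q⁴} S_p`: a non-distinct quadruple either
takes at most two values (at most `16 #Q²` such quadruples, each with `|S_p| ≤ p`) or has exactly one coincidence
(pattern `{u,u,v,w}`, contribution `≤ 0` after reordering the four factors). -/
theorem stub_degenerateQuadruples :
    ∀ (p : ℕ) [Fact p.Prime] (Q : Finset ℕ), (∀ a ∈ Q, a < p) →
      (∀ u ∈ Q, ∀ v ∈ Q, ∀ w ∈ Q, u ≠ v → u ≠ w → v ≠ w →
        (∑ x ∈ range p, legendreSym p (((x : ℤ) + u) * ((x : ℤ) + u) * ((x : ℤ) + v) * ((x : ℤ) + w))) ≤ 0) →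
      (∑ t ∈ ((Q ×ˢ Q) ×ˢ (Q ×ˢ Q)).filter (fun t : (ℕ × ℕ) × (ℕ × ℕ) =>
          ¬ (t.1.1 ≠ t.1.2 ∧ t.1.1 ≠ t.2.1 ∧ t.1.1 ≠ t.2.2 ∧ t.1.2 ≠ t.2.1 ∧ t.1.2 ≠ t.2.2 ∧ t.2.1 ≠ t.2.2)),
        ∑ x ∈ range p, legendreSym p
          (((x : ℤ) + t.1.1) * ((x : ℤ) + t.1.2) * ((x : ℤ) + t.2.1) * ((x : ℤ) + t.2.2))) ≤
      16 * (p : ℤ) * (Q.card : ℤ) ^ 2 := by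
  intro p _ Q _hQ h211
  have hp0 : (0 : ℤ) ≤ (p : ℤ) := Int.natCast_nonneg p
  calc (∑ t ∈ ((Q ×ˢ Q) ×ˢ (Q ×ˢ Q)).filter (fun t : (ℕ × ℕ) × (ℕ × ℕ) =>
          ¬ (t.1.1 ≠ t.1.2 ∧ t.1.1 ≠ t.2.1 ∧ t.1.1 ≠ t.2.2 ∧ t.1.2 ≠ t.2.1 ∧ t.1.2 ≠ t.2.2 ∧ t.2.1 ≠ t.2.2)),
        ∑ x ∈ range p, legendreSym p
          (((x : ℤ) + t.1.1) * ((x : ℤ) + t.1.2) * ((x : ℤ) + t.2.1) * ((x : ℤ) + t.2.2)))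
      ≤ ∑ t ∈ ((Q ×ˢ Q) ×ˢ (Q ×ˢ Q)).filter (fun t : (ℕ × ℕ) × (ℕ × ℕ) =>
          ¬ (t.1.1 ≠ t.1.2 ∧ t.1.1 ≠ t.2.1 ∧ t.1.1 ≠ t.2.2 ∧ t.1.2 ≠ t.2.1 ∧ t.1.2 ≠ t.2.2 ∧ t.2.1 ≠ t.2.2)),
        (if (t.1.1 = t.1.2 ∧ t.2.1 = t.2.2) ∨ (t.1.1 = t.2.1 ∧ t.1.2 = t.2.2) ∨
          (t.1.1 = t.2.2 ∧ t.1.2 = t.2.1) ∨ (t.1.1 = t.1.2 ∧ t.1.2 = t.2.1) ∨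
          (t.1.1 = t.1.2 ∧ t.1.2 = t.2.2) ∨ (t.1.1 = t.2.1 ∧ t.2.1 = t.2.2) ∨
          (t.1.2 = t.2.1 ∧ t.2.1 = t.2.2) then (p : ℤ) else 0) := by
        apply Finset.sum_le_sum
        intro t ht
        simp only [mem_filter, mem_product] at ht
        exact dq_term_le p Q h211 t.1.1 t.1.2 t.2.1 t.2.2 ht.1.1.1 ht.1.1.2 ht.1.2.1 ht.1.2.2 ht.2
    _ ≤ ∑ t ∈ (Q ×ˢ Q) ×ˢ (Q ×ˢ Q),
        (if (t.1.1 = t.1.2 ∧ t.2.1 = t.2.2) ∨ (t.1.1 = t.2.1 ∧ t.1.2 = t.2.2) ∨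
          (t.1.1 = t.2.2 ∧ t.1.2 = t.2.1) ∨ (t.1.1 = t.1.2 ∧ t.1.2 = t.2.1) ∨
          (t.1.1 = t.1.2 ∧ t.1.2 = t.2.2) ∨ (t.1.1 = t.2.1 ∧ t.2.1 = t.2.2) ∨
          (t.1.2 = t.2.1 ∧ t.2.1 = t.2.2) then (p : ℤ) else 0) :=
        Finset.sum_le_sum_of_subset_of_nonneg (filter_subset _ _)
          (fun t _ _ => by split_ifs <;> simp [hp0])
    _ = (p : ℤ) * ((((Q ×ˢ Q) ×ˢ (Q ×ˢ Q)).filter (fun t : (ℕ × ℕ) × (ℕ × ℕ) =>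
        (t.1.1 = t.1.2 ∧ t.2.1 = t.2.2) ∨ (t.1.1 = t.2.1 ∧ t.1.2 = t.2.2) ∨
          (t.1.1 = t.2.2 ∧ t.1.2 = t.2.1) ∨ (t.1.1 = t.1.2 ∧ t.1.2 = t.2.1) ∨
          (t.1.1 = t.1.2 ∧ t.1.2 = t.2.2) ∨ (t.1.1 = t.2.1 ∧ t.2.1 = t.2.2) ∨
          (t.1.2 = t.2.1 ∧ t.2.1 = t.2.2))).card : ℤ) := by
        rw [Finset.sum_ite, Finset.sum_const_zero, add_zero, Finset.sum_const, nsmul_eq_mul, mul_comm]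
    _ ≤ (p : ℤ) * ((16 * Q.card ^ 2 : ℕ) : ℤ) := by
        gcongr
        exact_mod_cast dq_card_twoValued_le Q
    _ = 16 * (p : ℤ) * (Q.card : ℤ) ^ 2 := by push_cast; ring

end Summit.ValiantsHypothesis.ValiantsHypothesis.Theorems.CharPSparseSOSTraceBias
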